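import Literature.MathematicalPhysics.QuantumLattice.GluedConnection
import Literature.MathematicalPhysics.QuantumLattice.GaugeCovarianceLocal
import Literature.MathematicalPhysics.QuantumLattice.YangMillsSphereGapSmallGauge
import HarnessLib

/-!
# The covariant gap `3 − Cε` on `S_r ⊂ ℝ⁴` for the Hodge-dual field: gauge-invariant form

QuantumLattice support file (everything proved; definitions with bodies, no named facts) on the
proof path of `Literature.MathematicalPhysics.QuantumLattice.Waldron2019_yangMillsFlow_flatTorus`
(A. Waldron, Invent. math. 217 (2019)). This is **Waldron's Lemma 3.5(a)** (first eigenvalue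
`≥ 4 − Cε` of the covariant Hodge Laplacian on closed 2-forms of `S³`) in the `u = ⋆(x ∧ F)`
formalism and for the ORIGINAL connection: for a `𝔲(N)`-valued `C⁴` connection `A` on `ℝ⁴` whose
curvature is bounded by `ε/r²` on the solid shell `r/4 ≤ ‖w‖ ≤ 2r` (`0 < ε ≤ ε₂(N)`),
`3 U ≤ (1 + C_N ε) X + 304 C_N ε U`,
`U = ∑ₐ ∮_{S_r}‖u_a‖²`, `X = ½∑ᵢⱼ∑ₐ ∮_{S_r}‖D^A_{L_{ij}} u_a‖²`, `u_a = hodgeSec e A a`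
(`sphere_covariant_gap_invariant`). Proof: the glued unitary small gauge (`GluedConnection`),
globalized by a radial cutoff (`globConn`), the small-gauge gap (`sphere_covariant_gap_small`)
and local gauge covariance (`GaugeCovarianceLocal`) with unitary invariance of the Frobenius norm.

References: A. Waldron, Invent. math. 217 (2019), Lemma 3.5(a) [Waldron2019]; [folklore].
-/

noncomputable section

open scoped RealInnerProductSpace Matrix.Norms.Frobenius ContDiff Topology
open Set Metric Filter MeasureTheory
open Literature.Analysis.InnerProduct Literature.Analysis.OperatorTheory Literature.Analysis.FluidPDE
  Literature.Analysis.Calculus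

namespace Literature.MathematicalPhysics.QuantumLattice

attribute [local instance] frobeniusInnerProductSpace

variable {N : ℕ}

local notation "𝔼" => EuclideanSpace ℝ (Fin 4)
local notation "𝕓" => EuclideanSpace.basisFun (Fin 4) ℝ
local notation "𝔤" => Matrix (Fin N) (Fin N) ℂ

/-! ### The radial cutoff and the globalized connection -/

/-- The radial plateau `ρ(s) = 1` for `0.85 ≤ s ≤ 1.15`, `= 0` for `s ≤ 0.7` or `s ≥ 1.3`.
[folklore] -/
def radialPlateau (s : ℝ) : ℝ :=
  Real.smoothTransition ((s - 7 / 10) / (3 / 20)) * Real.smoothTransition ((13 / 10 - s) / (3 / 20))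

/-- Auxiliary lemma (see the module docstring). [folklore] -/
theorem contDiff_radialPlateau {n : ℕ∞} : ContDiff ℝ n radialPlateau :=
  (Real.smoothTransition.contDiff.comp ((contDiff_id.sub contDiff_const).div_const _)).mul
    (Real.smoothTransition.contDiff.comp ((contDiff_const.sub contDiff_id).div_const _))

/-- Auxiliary lemma (see the module docstring). [folklore] -/
theorem radialPlateau_eq_one {s : ℝ} (h1 : 17 / 20 ≤ s) (h2 : s ≤ 23 / 20) : radialPlateau s = 1 := by
  rw [radialPlateau, Real.smoothTransition.one_of_one_le (by rw [le_div_iff₀ (by norm_num)]; linarith),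
    Real.smoothTransition.one_of_one_le (by rw [le_div_iff₀ (by norm_num)]; linarith), mul_one]

/-- Auxiliary lemma (see the module docstring). [folklore] -/
theorem radialPlateau_eq_zero {s : ℝ} (h : s ≤ 7 / 10 ∨ 13 / 10 ≤ s) : radialPlateau s = 0 := by
  rcases h with h | h
  · rw [radialPlateau, Real.smoothTransition.zero_of_nonpos (by rw [div_le_iff₀ (by norm_num)]; linarith),
      zero_mul]
  · rw [radialPlateau, mul_comm, Real.smoothTransition.zero_of_nonpos
      (by rw [div_le_iff₀ (by norm_num)]; linarith), zero_mul]

/-- **The globalized glued connection** `B̃(z) = ρ(‖z‖²/r²) B(z)`. [folklore] -/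
def globConn {A : Connection 𝔼 𝔤} (hA : ContDiff ℝ 1 A) (r : ℝ) : Connection 𝔼 𝔤 := fun z =>
  radialPlateau (‖z‖ ^ 2 / r ^ 2) • gluedConn hA r z

/-- The plateau neighbourhood of `S_r`: `{(17/20) r² < ‖z‖² < (23/20) r²}`. [folklore] -/
def plateauNbhd (r : ℝ) : Set 𝔼 := {z | 17 / 20 * r ^ 2 < ‖z‖ ^ 2 ∧ ‖z‖ ^ 2 < 23 / 20 * r ^ 2}

/-- Auxiliary lemma (see the module docstring). [folklore] -/
theorem isOpen_plateauNbhd (r : ℝ) : IsOpen (plateauNbhd r) :=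
  (isOpen_lt continuous_const (continuous_norm.pow 2)).and (isOpen_lt (continuous_norm.pow 2) continuous_const)

/-- Auxiliary lemma (see the module docstring). [folklore] -/
theorem plateauNbhd_subset_gluedNbhd {r : ℝ} (hr : 0 < r) : plateauNbhd r ⊆ gluedNbhd r := by
  intro z hz
  obtain ⟨h1, h2⟩ := hz
  have hz0 := norm_nonneg z
  constructor
  · nlinarith
  · nlinarith

/-- Auxiliary lemma (see the module docstring). [folklore] -/
theorem mem_plateauNbhd_of_norm_eq {r : ℝ} (hr : 0 < r) {z : 𝔼} (hz : ‖z‖ = r) : z ∈ plateauNbhd r := by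
  constructor <;> rw [hz] <;> nlinarith

/-- On the plateau neighbourhood `B̃ = B`. [folklore] -/
theorem globConn_eq_of_mem {A : Connection 𝔼 𝔤} (hA : ContDiff ℝ 1 A) {r : ℝ} (hr : 0 < r) {z : 𝔼}
    (hz : z ∈ plateauNbhd r) : globConn hA r z = gluedConn hA r z := by
  obtain ⟨h1, h2⟩ := hz
  have hr2 : 0 < r ^ 2 := by positivity
  rw [globConn, radialPlateau_eq_one, one_smul]
  · rw [le_div_iff₀ hr2]; linarith
  · rw [div_le_iff₀ hr2]; linarith

/-! ### Global smoothness of `B̃` -/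

section Smooth

/-- `z ↦ ρ(‖z‖²/r²)` is smooth. [folklore] -/
theorem contDiff_radialPlateau_normSq {n : ℕ∞} (r : ℝ) :
    ContDiff ℝ n fun z : 𝔼 => radialPlateau (‖z‖ ^ 2 / r ^ 2) :=
  contDiff_radialPlateau.comp ((contDiff_norm_sq ℝ).div_const _)

/-- **`B̃` is `C^n` on all of `ℝ⁴`** when `A ∈ C^{n+1}` (`n ≥ 1`, `ε ≤ ε₁`). [folklore] -/
theorem contDiff_globConn [NeZero N] {n : ℕ∞} {A : Connection 𝔼 𝔤} (hA1 : ContDiff ℝ 1 A)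
    (hA2 : ContDiff ℝ 2 A) (hA : ContDiff ℝ (n + 1) A) (hskew : IsSkewValued A) {r ε : ℝ}
    (hr : 0 < r) (hε0 : 0 ≤ ε) (hε1 : ε ≤ epsOne N) (hF : ShellCurvatureBound A r ε) :
    ContDiff ℝ n (globConn hA1 r) := by
  have hB := contDiffOn_gluedConn hA1 hA2 hA hskew hr hε0 hε1 hF
  have hon : ContDiffOn ℝ n (globConn hA1 r) (gluedNbhd r) := by
    unfold globConn
    exact (contDiff_radialPlateau_normSq r).contDiffOn.smul hB
  rw [contDiff_iff_contDiffAt]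
  intro z
  by_cases hz : z ∈ gluedNbhd r
  · exact hon.contDiffAt ((isOpen_gluedNbhd r).mem_nhds hz)
  · -- off the shell `B̃` vanishes identically near `z`
    have hV : IsOpen {y : 𝔼 | ‖y‖ ^ 2 < 7 / 10 * r ^ 2 ∨ 13 / 10 * r ^ 2 < ‖y‖ ^ 2} :=
      (isOpen_lt (continuous_norm.pow 2) continuous_const).union (isOpen_lt continuous_const (continuous_norm.pow 2))
    have hzV : z ∈ {y : 𝔼 | ‖y‖ ^ 2 < 7 / 10 * r ^ 2 ∨ 13 / 10 * r ^ 2 < ‖y‖ ^ 2} := by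
      simp only [gluedNbhd, mem_setOf_eq, not_and_or, not_lt] at hz
      have hz0 := norm_nonneg z
      rcases hz with h | h
      · left; nlinarith
      · right; nlinarith
    have hev : globConn hA1 r =ᶠ[𝓝 z] fun _ => (0 : Connection 𝔼 𝔤) z := by
      filter_upwards [hV.mem_nhds hzV] with y hy
      have hr2 : 0 < r ^ 2 := by positivity
      have hρ : radialPlateau (‖y‖ ^ 2 / r ^ 2) = 0 := by
        refine radialPlateau_eq_zero ?_
        rcases hy with h | h
        · left; rw [div_le_iff₀ hr2]; linarith
        · right; rw [le_div_iff₀ hr2]; linarith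
      simp only [globConn, hρ, zero_smul]
      rfl
    exact contDiffAt_const.congr_of_eventuallyEq hev

end Smooth

/-! ### The gauge-invariant gap -/

section Gap

/-- The constant `C_N = 6/5 + kDerivConst N Cχ` with a chosen bound `Cχ` for `|χ'|`. [folklore] -/
def gapGlueConst (N : ℕ) : ℝ := 6 / 5 + kDerivConst N (Classical.choose exists_deriv_gluedStep_bound)

/-- Auxiliary lemma (see the module docstring). [folklore] -/
theorem gapGlueConst_pos (N : ℕ) : 0 < gapGlueConst N := by
  have h := (Classical.choose_spec exists_deriv_gluedStep_bound).1
  have := kDerivConst_nonneg N h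
  unfold gapGlueConst; linarith

/-- The smallness threshold `ε₂ = min ε₁ (1 / C_N)`. [folklore] -/
def epsTwo (N : ℕ) : ℝ := min (epsOne N) (1 / gapGlueConst N)

/-- **Waldron's Lemma 3.5(a) in the `u`-formalism, gauge-invariant form.** For a `𝔲(N)`-valued
`C⁴` connection `A` on `ℝ⁴` (`N ≥ 1`) with `‖F(w)(v,v')‖ ≤ (ε/r²)‖v‖‖v'‖` on the solid shell
`r/4 ≤ ‖w‖ ≤ 2r`, `0 < ε ≤ ε₂(N)`: with `u_a = hodgeSec e A a` and `C = gapGlueConst N`,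
`3 ∑ₐ∮_{S_r}‖u_a‖² ≤ (1 + Cε) ½∑ᵢⱼ∑ₐ∮_{S_r}‖D^A_{L_{ij}}u_a‖² + 304 C ε ∑ₐ∮_{S_r}‖u_a‖²`.
[cite: Waldron2019, Lemma 3.5(a)] -/
theorem sphere_covariant_gap_invariant [NeZero N] {A : Connection 𝔼 𝔤} (hA : ContDiff ℝ 4 A)
    (hskew : IsSkewValued A) {r ε : ℝ} (hr : 0 < r) (hε0 : 0 < ε) (hε2 : ε ≤ epsTwo N)
    (hF : ShellCurvatureBound A r ε) :
    3 * ∑ a, sphereIntegral (volume : Measure 𝔼) (fun x => ‖hodgeSec 𝕓 A a x‖ ^ 2) r ≤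
      (1 + gapGlueConst N * ε) * ((1 / 2) * ∑ i, ∑ j, ∑ a, sphereIntegral (volume : Measure 𝔼)
          (fun x => ‖covDeriv A (hodgeSec 𝕓 A a) x (angularField 𝕓 i j x)‖ ^ 2) r) +
        304 * (gapGlueConst N * ε) *
          ∑ a, sphereIntegral (volume : Measure 𝔼) (fun x => ‖hodgeSec 𝕓 A a x‖ ^ 2) r := by
  -- smoothness levels
  have hA1 : ContDiff ℝ 1 A := hA.of_le (by norm_num)
  have hA2 : ContDiff ℝ 2 A := hA.of_le (by norm_num)
  have hA31 : ContDiff ℝ ((3 : ℕ∞) + 1 : ℕ∞) A := by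
    rw [show ((3 : ℕ∞) + 1 : ℕ∞) = 4 by norm_num]; exact_mod_cast hA
  have hε1 : ε ≤ epsOne N := hε2.trans (min_le_left _ _)
  have hεC : gapGlueConst N * ε ≤ 1 := by
    have h := hε2.trans (min_le_right _ _)
    have hC := gapGlueConst_pos N
    calc gapGlueConst N * ε ≤ gapGlueConst N * (1 / gapGlueConst N) := mul_le_mul_of_nonneg_left h hC.le
      _ = 1 := by field_simp
  set Cχ := Classical.choose exists_deriv_gluedStep_bound with hCχ_def
  have hCχ0 : 0 ≤ Cχ := (Classical.choose_spec exists_deriv_gluedStep_bound).1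
  have hCχ : ∀ t, ‖deriv gluedStep t‖ ≤ Cχ := (Classical.choose_spec exists_deriv_gluedStep_bound).2
  -- the globalized glued connection
  set B := globConn hA1 r with hB_def
  have hB3 : ContDiff ℝ 3 B := contDiff_globConn (n := 3) hA1 hA2 hA31 hskew hr hε0.le hε1 hF
  set δ : ℝ := gapGlueConst N * ε with hδ
  have hδ0 : 0 < δ := mul_pos (gapGlueConst_pos N) hε0
  -- smallness on the sphere
  have hsmall : ∀ y : 𝔼, ‖y‖ = r → ∀ v : 𝔼, ‖B y v‖ ≤ δ / r * ‖v‖ := by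
    intro y hy v
    have heq : B y v = gluedConn hA1 r y v := by
      rw [hB_def, globConn_eq_of_mem hA1 hr (mem_plateauNbhd_of_norm_eq hr hy)]
    rw [heq]
    refine (norm_gluedConn_le_sphere hA1 hA2 hskew hr hε0.le hε1 hF hCχ0 hCχ hy v).trans (le_of_eq ?_)
    rw [hδ, gapGlueConst]; ring
  have hgap := sphere_covariant_gap_small hB3 hr hδ0 hεC hsmall
  -- ### gauge covariance on the sphere
  set g := gluedGauge hA1 r with hg_def
  have hU : IsOpen (plateauNbhd r) := isOpen_plateauNbhd r
  have hsub := plateauNbhd_subset_gluedNbhd hr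
  have hgs : ContDiffOn ℝ 2 g (plateauNbhd r) :=
    (contDiffOn_gluedGauge (n := 2) (by norm_num) hA1 hA2 hA2 hskew hr hε0.le hε1 hF).mono hsub
  have hgis : ContDiffOn ℝ 2 (fun y => star (g y)) (plateauNbhd r) :=
    (starL' ℝ : 𝔤 ≃L[ℝ] 𝔤).contDiff.comp_contDiffOn hgs
  have hinv : ∀ y ∈ plateauNbhd r, star (g y) * g y = 1 ∧ g y * star (g y) = 1 := fun y hy =>
    Unitary.mem_iff.1 (gluedGauge_mem_unitary hA1 hA2 hskew hr hε0.le hε1 hF (hsub hy))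
  have hBform : ∀ y ∈ plateauNbhd r, ∀ w, B y w = star (g y) * A y w * g y + star (g y) * fderiv ℝ g y w := by
    intro y hy w
    rw [hB_def, globConn_eq_of_mem hA1 hr hy, gluedConn_apply]
  have hcovD : ∀ z : 𝔼, ‖z‖ = r → ∀ a v, covDeriv B (hodgeSec 𝕓 B a) z v =
      star (g z) * covDeriv A (hodgeSec 𝕓 A a) z v * g z := fun z hz a v =>
    covDeriv_hodgeSec_conj_local 𝕓 hU (mem_plateauNbhd_of_norm_eq hr hz) hgs hgis hinv hA2 hBform a v
  have hsec : ∀ z : 𝔼, ‖z‖ = r → ∀ a, hodgeSec 𝕓 B a z = star (g z) * hodgeSec 𝕓 A a z * g z :=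
    fun z hz a => hodgeSec_conj_of_curvature 𝕓 (fun u w => curvature_conj_local hU
      (mem_plateauNbhd_of_norm_eq hr hz) hgs hgis hinv (hA2.differentiable two_ne_zero) hBform u w) a
  have hgu : ∀ z : 𝔼, ‖z‖ = r → g z ∈ unitary 𝔤 := fun z hz =>
    gluedGauge_mem_unitary hA1 hA2 hskew hr hε0.le hε1 hF (hsub (mem_plateauNbhd_of_norm_eq hr hz))
  -- pointwise equality of the norms on the sphere
  have hU_eq : ∀ a, sphereIntegral (volume : Measure 𝔼) (fun x => ‖hodgeSec 𝕓 B a x‖ ^ 2) r =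
      sphereIntegral (volume : Measure 𝔼) (fun x => ‖hodgeSec 𝕓 A a x‖ ^ 2) r := by
    intro a
    refine sphereIntegral_congr_norm hr.le fun x hx => ?_
    rw [hsec x hx a, norm_mul_unitary (hgu x hx), norm_unitary_mul (Unitary.star_mem (hgu x hx))]
  have hX_eq : ∀ i j a, sphereIntegral (volume : Measure 𝔼)
      (fun x => ‖covDeriv B (hodgeSec 𝕓 B a) x (angularField 𝕓 i j x)‖ ^ 2) r =
      sphereIntegral (volume : Measure 𝔼)
        (fun x => ‖covDeriv A (hodgeSec 𝕓 A a) x (angularField 𝕓 i j x)‖ ^ 2) r := by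
    intro i j a
    refine sphereIntegral_congr_norm hr.le fun x hx => ?_
    rw [hcovD x hx a, norm_mul_unitary (hgu x hx), norm_unitary_mul (Unitary.star_mem (hgu x hx))]
  simp only [hU_eq, hX_eq] at hgap
  exact hgap

end Gap

end Literature.MathematicalPhysics.QuantumLattice
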